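import Literature.AlgebraicGeometry.ModuliOfAbelianVarieties.SiegelLinearRigidificationBaseChange
import Literature.AlgebraicGeometry.Morphisms.ProjectiveFrameLocusLinearInvariance
import Literature.AlgebraicGeometry.Modules.FrameMatrixEnd
import Literature.AlgebraicGeometry.Motives.GeneratingSectionsLinearChange
import HarnessLib

/-!
# A linear rigidification moved by `GL_{m+1}(Γ(T, 𝒪_T))` is again a linear rigidification (F-8 brick «LR-ACT»)

Topic `AlgebraicGeometry/ModuliOfAbelianVarieties`; namespaces `Literature.AlgebraicGeometry.Morphisms` (§1),
`Literature.AlgebraicGeometry.Motives.GeneratingSections` (§2) and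
`Literature.AlgebraicGeometry.AbelianSchemes.PolarizedAbelianSchemeWithLevel` (§3).  THEOREMS ONLY (no definition, no named
fact, no instance, no notation, no `sorry`).  Cell `hodgecm-mathlib` (D-0151), F-DAG row F-8 «the quotient `A⁰ := H ∕ GL_{m+1}` by
slices», brick «LR-ACT» (sequencer B-plan1 (g17) 2026-08-30T09:23:21Z (3); consumer: the slice-representability file (8γ-E)
`ModuliOfAbelianVarieties/SiegelModuliFrameSliceRepresents`, step (e4) «move the local frame rigidification by the transporter to
standard position and classify again»).  Count-neutral capital: HC_CM is proved only modulo the 7 printed citations until rung 0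
closes — nothing here bears on a summit statement.

## Source and content

[MumfordFogartyKirwan1994] Ch. 7 §2 Prop. 7.6 (p. 136): «`PGL(m+1)` acts on this functor [polarized abelian schemes with level
structure plus a linear rigidification, Def. 7.5 (p. 130)] in the obvious way: by changing the rigidification».  [Hartshorne1977]
II Thm. 7.1 / Example 7.1.1 (pp. 150–151): the morphism to `ℙⁿ` of generating sections; `‖a_{ij}‖` acts by `x_i' = Σ_j a_{ij} x_j`.
In the tree's letter — ★ (8α) `IsFrameRigidification J P ι` (`ι : X → 𝐏^m_ℤ` is the point of `𝐏(J; T)` of the basis sections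
of a global frame `e : 𝒪_T^{m+1} ≅ π_*(L^Δ(λ)^{⊗3})`), `IsLinearRigidification` (the same Zariski-locally on `T`), and the
`S`-free action `M • q := ⟨T → Spec Γ(T, 𝒪_T), q⟩ ≫ actCore J M` of ★ (8β-a) `Morphisms/ProjectiveFrameLocusLinearInvariance`:

* §1 **`Morphisms.exists_frame_basisSection_eq_sum_smul`** — the frame `e` of `f_*E` MOVED by `M ∈ GL_{n+1}(Γ(T, 𝒪_T))` (`e`
  followed by the automorphism with matrix `ᵗM` in `e`, ★ `Modules.matrixEnd`) has basis sections `b'_j = Σ_i f^*(M_{ji}) · b_i`.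
* §2 **`GeneratingSections.iSup_basicOpen_coeffAt_eq_top_of_eq_sum_smul`** — generation survives `t ↦ M t` (read in
  `κ(p)`, ★ `ProjFrame.exists_isUnit_mulVec_apply`); **`GeneratingSections.exists_frame_homEquiv_pointOfSections_eq_lift_actCore`** — the
  `𝐏ⁿ_ℤ`-component of the point of `𝐏(J; T)` of the moved frame is `f^*M •` that of `e` (★ (U-a)
  `GeneratingSections.toProj_ofFrameSystem_eq_lift_actCore_of_eq_sum_smul`, `Motives/GeneratingSectionsLinearChange`).
* §3 **`IsFrameRigidification.lift_actCore`** (LR-ACT, global frames), **`IsLinearRigidification.lift_actCore`** (same cover, ★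
  `ProjFrame.comp_lift_actCore`), **`IsFrameRigidification.isLinearRigidification_lift_actCore`** (the consumer's letter over a
  locally Noetherian base, ★ (hBC) `IsFrameRigidification.isLinearRigidification`).

## References
* [MumfordFogartyKirwan1994] D. Mumford, J. Fogarty, F. Kirwan, *Geometric Invariant Theory*, 3rd ed. (1994): Ch. 7 §2
  Definition 7.5 (p. 130), Proposition 7.6 (p. 136).
* [Hartshorne1977] R. Hartshorne, *Algebraic Geometry*, GTM 52 (1977): II §5 (p. 110), II Thm. 7.1 (p. 150), II Example 7.1.1
  (p. 151).
* [GortzWedhorn2020] U. Görtz, T. Wedhorn, *Algebraic Geometry I: Schemes*, 2nd ed. (2020): Definition 4.44 (p. 117).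
-/

noncomputable section

-- `Scheme.Modules` section API and pull-back bookkeeping across semireducible wrappers (as in ★ (8α), ★ (8β-a)).
set_option backward.isDefEq.respectTransparency false

open CategoryTheory CategoryTheory.Limits AlgebraicGeometry TopologicalSpace Opposite Matrix
open Literature.AlgebraicGeometry.Modules
open Literature.AlgebraicGeometry.Motives Literature.AlgebraicGeometry.Motives.GeneratingSections
open Literature.AlgebraicGeometry.Morphisms (intU projectiveSpaceInt isPullback_projToSpec_projMap_terminal)
open Literature.AlgebraicGeometry.GroupSchemes.GeneralLinearGroupScheme (intCast actCore)
open Literature.AlgebraicGeometry.ProjectiveSpace.ProjFrame (exists_isUnit_mulVec_apply)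


/-! ## §1 Moving a frame of `f_*E` by an invertible matrix over the base -/

namespace Literature.AlgebraicGeometry.Morphisms

section MoveFrame

variable {X T : Scheme.{0}} (f : X ⟶ T) (E : X.Modules) {n : ℕ}
  (e : SheafOfModules.free (Fin (n + 1)) ≅ ((Scheme.Modules.pushforward f).obj E).over ⊤)
  (M : GL (Fin (n + 1)) Γ(T, ⊤))

/-- The basis sections of a frame followed by an automorphism of the restricted module are the images of the basis
sections. [cite: Hartshorne1977, II §5 (p. 110)] -/
private theorem basisSection_trans_appLE {Y : Scheme.{0}} {N : Y.Modules} {W : Y.Opens} {I : Type}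
    (e₁ : SheafOfModules.free I ≅ N.over W) (ψ : N.over W ≅ N.over W) (l : I) :
    basisSection (e₁ ≪≫ ψ) l = appLE ψ.hom (𝟙 W) (basisSection e₁ l) := by
  rw [basisSection, basisSection, Iso.trans_hom, SheafOfModules.freeHomEquiv_comp_apply,
    overSectionsEquiv_sectionsMap']

/-- **A frame of `f_*E` MOVED BY `M ∈ GL_{n+1}(Γ(T, 𝒪_T))` is a frame of `f_*E`** whose basis sections, read as
sections of `E` on `X`, are `b'_j = Σ_i f^*(M_{ji}) · b_i` (the frame `e` followed by the automorphism of `f_*E` with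
matrix `ᵗM` in `e`, ★ `Modules.matrixEnd`). [cite: Hartshorne1977, II §5 (p. 110)]
[cite: MumfordFogartyKirwan1994, Ch. 7 §2 Prop. 7.6 (p. 136)] -/
theorem exists_frame_basisSection_eq_sum_smul :
    ∃ e' : SheafOfModules.free (Fin (n + 1)) ≅ ((Scheme.Modules.pushforward f).obj E).over ⊤,
      ∀ j, (show Γ(E, ⊤) from (basisSection e' j :)) =
        ∑ i, f.appTop ((M : Matrix (Fin (n + 1)) (Fin (n + 1)) Γ(T, ⊤)) j i) •
          (show Γ(E, ⊤) from (basisSection e i :)) := by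
  classical
  set A : Matrix (Fin (n + 1)) (Fin (n + 1)) Γ(T, ⊤) := (M : Matrix (Fin (n + 1)) (Fin (n + 1)) Γ(T, ⊤))ᵀ with hA
  set A' : Matrix (Fin (n + 1)) (Fin (n + 1)) Γ(T, ⊤) :=
    ((M⁻¹ : GL (Fin (n + 1)) Γ(T, ⊤)) : Matrix (Fin (n + 1)) (Fin (n + 1)) Γ(T, ⊤))ᵀ with hA'
  have hAA' : A * A' = 1 := by
    rw [hA, hA', ← Matrix.transpose_mul, ← Matrix.GeneralLinearGroup.coe_mul, inv_mul_cancel,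
      Matrix.GeneralLinearGroup.coe_one, Matrix.transpose_one]
  have hA'A : A' * A = 1 := by
    rw [hA, hA', ← Matrix.transpose_mul, ← Matrix.GeneralLinearGroup.coe_mul, mul_inv_cancel,
      Matrix.GeneralLinearGroup.coe_one, Matrix.transpose_one]
  let ψ : ((Scheme.Modules.pushforward f).obj E).over ⊤ ≅ ((Scheme.Modules.pushforward f).obj E).over ⊤ :=
    ⟨matrixEnd e (𝟙 ⊤) A, matrixEnd e (𝟙 ⊤) A', by rw [matrixEnd_comp, hA'A, matrixEnd_one],
      by rw [matrixEnd_comp, hAA', matrixEnd_one]⟩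
  refine ⟨e ≪≫ ψ, fun j => ?_⟩
  change basisSection (e ≪≫ ψ) j = _
  rw [basisSection_trans_appLE]
  change appLE (matrixEnd e (𝟙 ⊤) A) (𝟙 ⊤) (basisSection e j) = _
  have h := appLE_matrixEnd_basisSection e (𝟙 (⊤ : T.Opens)) A j
  simp only [presheaf_map_id] at h
  rw [h]
  rfl

end MoveFrame

end Literature.AlgebraicGeometry.Morphisms

/-! ## §2 Generation and the point of `𝐏ⁿ` under an invertible linear change of the sections -/

namespace Literature.AlgebraicGeometry.Motives.GeneratingSections

section Generation

variable {X : Scheme.{0}} {E : X.Modules} (F : FrameSystem E) (h1 : ∀ x, F.rank x = 1) {n : ℕ}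
  (t t' : Fin (n + 1) → Γ(E, ⊤)) (Mx : GL (Fin (n + 1)) Γ(X, ⊤))

/-- **Generation is invariant under an invertible linear change of the sections**: if the non-vanishing loci of the
coefficients of the `t_i` cover `X` and `t'_j = Σ_k M_{jk} t_k` with `M ∈ GL_{n+1}(Γ(X, 𝒪_X))`, those of the `t'_j` cover `X`
too (at a point `p` the coefficient vector of the `t_i` is non-zero in `κ(p)`, hence so is its image under the invertible
matrix `M(p)`; ★ `coeffAt_sum_smul`, ★ `ProjFrame.exists_isUnit_mulVec_apply`).
[cite: Hartshorne1977, II Thm. 7.1 (p. 150)] [cite: GortzWedhorn2020, Definition 4.44 (p. 117)] -/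
theorem iSup_basicOpen_coeffAt_eq_top_of_eq_sum_smul
    (ht' : ∀ j, t' j = ∑ k, (Mx : Matrix (Fin (n + 1)) (Fin (n + 1)) Γ(X, ⊤)) j k • t k)
    (hcov : ⨆ i, ⨆ x, X.basicOpen (coeffAt F h1 t i x) = ⊤) :
    ⨆ j, ⨆ x, X.basicOpen (coeffAt F h1 t' j x) = ⊤ := by
  rw [iSup_basicOpen_coeffAt_eq_top_iff] at hcov ⊢
  intro p
  obtain ⟨a, ha⟩ := hcov p
  -- read the coefficient vectors in the residue field `κ(p)`
  let ev : Γ(X, F.U p) →+* X.residueField p := (X.evaluation (F.U p) p (F.mem p)).hom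
  let ρ : Γ(X, ⊤) →+* Γ(X, F.U p) := (X.presheaf.map (homOfLE (le_top : F.U p ≤ ⊤)).op).hom
  let θ : Fin (n + 1) → X.residueField p := fun i => ev (coeffAt F h1 t i p)
  have hθ : IsUnit (θ a) :=
    isUnit_iff_ne_zero.mpr ((X.evaluation_ne_zero_iff_mem_basicOpen p (F.mem p) _).mpr ha)
  obtain ⟨b, hb⟩ := exists_isUnit_mulVec_apply (fun v hv => isUnit_iff_ne_zero.mpr hv)
    (Matrix.GeneralLinearGroup.map (ev.comp ρ) Mx) θ hθ
  refine ⟨b, (X.evaluation_ne_zero_iff_mem_basicOpen p (F.mem p) _).mp ?_⟩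
  have key : ev (coeffAt F h1 t' b p) =
      ((Matrix.GeneralLinearGroup.map (ev.comp ρ) Mx : Matrix (Fin (n + 1)) (Fin (n + 1)) (X.residueField p)) *ᵥ θ)
        b := by
    rw [coeffAt_sum_smul F h1 Finset.univ (fun k => (Mx : Matrix (Fin (n + 1)) (Fin (n + 1)) Γ(X, ⊤)) b k) t t' b
      (ht' b) p, map_sum, Matrix.mulVec, dotProduct]
    refine Finset.sum_congr rfl fun i _ => ?_
    rw [map_mul]
    rfl
  change ev _ ≠ 0
  rw [key]
  exact hb.ne_zero

end Generation

section Point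

variable {X T : Scheme.{0}} (J : Type) (f : X ⟶ T) {E : X.Modules} (F : FrameSystem E) (h1 : ∀ x, F.rank x = 1)
  (e : SheafOfModules.free (Fin (Nat.card J + 1)) ≅ ((Scheme.Modules.pushforward f).obj E).over ⊤)
  (hcov : ⨆ i, ⨆ x, X.basicOpen ((CocycleSections.ofFrameSystem F h1 fun j ↦ (basisSection e j :)).coeff i x) = ⊤)
  (M : GL (Fin (Nat.card J + 1)) Γ(T, ⊤))

include hcov in
/-- **The point of `𝐏ⁿ` of the moved frame is the moved point**: for a rank-one frame system `F` of `E` and a frame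
`e` of `f_*E` whose basis sections generate, the frame `e'` moved by `M ∈ GL_{n+1}(Γ(T, 𝒪_T))` (§1) has generating basis
sections, and the `𝐏ⁿ_ℤ`-component of the point of `𝐏(J; T)` they define is `f^*M •` that of `e` — ★ (U-a)
`toProj_ofFrameSystem_eq_lift_actCore_of_eq_sum_smul` in the letter of ★ `Morphisms.projectiveSpace.pointOfSections` ∕
`homEquiv`. [cite: Hartshorne1977, II Thm. 7.1 (p. 150) and Example 7.1.1 (p. 151)] [cite: GortzWedhorn2020, Definition 4.44 (p. 117)] -/
theorem exists_frame_homEquiv_pointOfSections_eq_lift_actCore :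
    letI : Algebra intU.{0} Γ(X, ⊤) := (intCast _).toAlgebra
    ∃ (e' : SheafOfModules.free (Fin (Nat.card J + 1)) ≅ ((Scheme.Modules.pushforward f).obj E).over ⊤)
      (hcov' : ⨆ i, ⨆ x, X.basicOpen
        ((CocycleSections.ofFrameSystem F h1 fun j ↦ (basisSection e' j :)).coeff i x) = ⊤),
      Morphisms.projectiveSpace.homEquiv (Over.mk f)
          (Morphisms.projectiveSpace.pointOfSections (Over.mk f)
            (ofCocycleSections F.U (CocycleSections.ofFrameSystem F h1 fun j ↦ (basisSection e' j :)) hcov')) =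
        (isPullback_projToSpec_projMap_terminal J Γ(X, ⊤)).lift X.toSpecΓ
            (Morphisms.projectiveSpace.homEquiv (Over.mk f)
              (Morphisms.projectiveSpace.pointOfSections (Over.mk f)
                (ofCocycleSections F.U (CocycleSections.ofFrameSystem F h1 fun j ↦ (basisSection e j :)) hcov)))
            (terminal.hom_ext _ _) ≫
          actCore J (Matrix.GeneralLinearGroup.map f.appTop.hom M) := by
  letI : Algebra intU.{0} Γ(X, ⊤) := (intCast _).toAlgebra
  obtain ⟨e', he'⟩ := Literature.AlgebraicGeometry.Morphisms.exists_frame_basisSection_eq_sum_smul f E e M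
  -- the moved basis sections are `f^*M` times the old ones
  have ht' : ∀ j, (show Γ(E, ⊤) from (basisSection e' j :)) =
      ∑ k, ((Matrix.GeneralLinearGroup.map f.appTop.hom M : GL (Fin (Nat.card J + 1)) Γ(X, ⊤)) :
          Matrix (Fin (Nat.card J + 1)) (Fin (Nat.card J + 1)) Γ(X, ⊤)) j k •
        (show Γ(E, ⊤) from (basisSection e k :)) := fun j ↦ by
    rw [he' j]
    rfl
  have hcov' : ⨆ i, ⨆ x, X.basicOpen
      ((CocycleSections.ofFrameSystem F h1 fun j ↦ (basisSection e' j :)).coeff i x) = ⊤ := by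
    simp only [CocycleSections.ofFrameSystem_coeff] at hcov ⊢
    exact iSup_basicOpen_coeffAt_eq_top_of_eq_sum_smul F h1 _ _ _ ht' hcov
  refine ⟨e', hcov', ?_⟩
  rw [Morphisms.projectiveSpace.homEquiv_pointOfSections, Morphisms.projectiveSpace.homEquiv_pointOfSections]
  exact toProj_ofFrameSystem_eq_lift_actCore_of_eq_sum_smul J (Matrix.GeneralLinearGroup.map f.appTop.hom M) F h1
    _ _ ht' hcov hcov' _

end Point

end Literature.AlgebraicGeometry.Motives.GeneratingSections

/-! ## §3 Linear rigidifications of polarised abelian schemes with level structure -/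

namespace Literature.AlgebraicGeometry.AbelianSchemes

namespace PolarizedAbelianSchemeWithLevel

variable {g N : ℕ} {δ : Fin g → ℕ} (J : Type) {T : Scheme.{0}} {P : PolarizedAbelianSchemeWithLevel g N δ T}
  {ι : P.A.X.left ⟶ projectiveSpaceInt J}

/-- **LR-ACT, global form: a FRAME rigidification moved by `M ∈ GL_{m+1}(Γ(T, 𝒪_T))` is a frame rigidification.**
If `ι : X → 𝐏^m_ℤ` is the morphism of a global frame `e` of `π_*(L^Δ(λ)^{⊗3})`, then `π^*M • ι` is the morphism of the
moved frame (§1) — [MumfordFogartyKirwan1994] Prop. 7.6: `PGL(m+1)` acts on the linearly rigidified functor by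
changing the rigidification. [cite: MumfordFogartyKirwan1994, Ch. 7 §2 Prop. 7.6 (p. 136)]
[cite: MumfordFogartyKirwan1994, Ch. 7 §2 Def. 7.5 (p. 130)] -/
theorem IsFrameRigidification.lift_actCore (h : P.IsFrameRigidification J ι)
    (M : GL (Fin (Nat.card J + 1)) Γ(T, ⊤)) :
    letI : Algebra intU.{0} Γ(P.A.X.left, ⊤) := (intCast _).toAlgebra
    P.IsFrameRigidification J
      ((isPullback_projToSpec_projMap_terminal J Γ(P.A.X.left, ⊤)).lift P.A.X.left.toSpecΓ ι
          (terminal.hom_ext _ _) ≫ actCore J (Matrix.GeneralLinearGroup.map P.A.X.hom.appTop.hom M)) := by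
  letI : Algebra intU.{0} Γ(P.A.X.left, ⊤) := (intCast _).toAlgebra
  obtain ⟨Gr, hGr₁, hGr₂, F, h1, e, hcov, hι⟩ := h
  obtain ⟨e', hcov', heq⟩ :=
    GeneratingSections.exists_frame_homEquiv_pointOfSections_eq_lift_actCore J P.A.X.hom F h1 e hcov M
  refine ⟨Gr, hGr₁, hGr₂, F, h1, e', hcov', ?_⟩
  rw [heq, hι]

/-- **LR-ACT: a LINEAR rigidification moved by `M ∈ GL_{m+1}(Γ(T, 𝒪_T))` is a linear rigidification** (on the same
cover: the restriction of `π^*M • ι` to `X ×_T 𝒰ᵢ` is the restricted frame rigidification moved by `M|_{𝒰ᵢ}`, ★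
`ProjFrame.comp_lift_actCore`). [cite: MumfordFogartyKirwan1994, Ch. 7 §2 Prop. 7.6 (p. 136)]
[cite: GortzWedhorn2020, Definition 4.44 (p. 117)] -/
theorem IsLinearRigidification.lift_actCore (h : P.IsLinearRigidification J ι)
    (M : GL (Fin (Nat.card J + 1)) Γ(T, ⊤)) :
    letI : Algebra intU.{0} Γ(P.A.X.left, ⊤) := (intCast _).toAlgebra
    P.IsLinearRigidification J
      ((isPullback_projToSpec_projMap_terminal J Γ(P.A.X.left, ⊤)).lift P.A.X.left.toSpecΓ ι
          (terminal.hom_ext _ _) ≫ actCore J (Matrix.GeneralLinearGroup.map P.A.X.hom.appTop.hom M)) := by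
  letI : Algebra intU.{0} Γ(P.A.X.left, ⊤) := (intCast _).toAlgebra
  obtain ⟨𝒰, h𝒰⟩ := h
  refine ⟨𝒰, fun i => ?_⟩
  letI : Algebra intU.{0} Γ((P.baseChange (𝒰.f i)).A.X.left, ⊤) := (intCast _).toAlgebra
  have key := (h𝒰 i).lift_actCore J (Matrix.GeneralLinearGroup.map (𝒰.f i).appTop.hom M)
  have hring : (pullback.fst P.A.X.hom (𝒰.f i)).appTop.hom.comp P.A.X.hom.appTop.hom =
      (P.baseChange (𝒰.f i)).A.X.hom.appTop.hom.comp (𝒰.f i).appTop.hom := by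
    change _ = (pullback.snd P.A.X.hom (𝒰.f i)).appTop.hom.comp (𝒰.f i).appTop.hom
    rw [← CommRingCat.hom_comp, ← CommRingCat.hom_comp, ← Scheme.Hom.comp_appTop, ← Scheme.Hom.comp_appTop,
      pullback.condition]
  have hM : Matrix.GeneralLinearGroup.map (P.baseChange (𝒰.f i)).A.X.hom.appTop.hom
        (Matrix.GeneralLinearGroup.map (𝒰.f i).appTop.hom M) =
      Matrix.GeneralLinearGroup.map (pullback.fst P.A.X.hom (𝒰.f i)).appTop.hom
        (Matrix.GeneralLinearGroup.map P.A.X.hom.appTop.hom M) := by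
    rw [← Matrix.GeneralLinearGroup.map_comp_apply, ← Matrix.GeneralLinearGroup.map_comp_apply,
      ← Matrix.GeneralLinearGroup.map_comp, ← Matrix.GeneralLinearGroup.map_comp]
    exact congrArg (fun φ => Matrix.GeneralLinearGroup.map φ M) hring.symm
  rw [hM] at key
  rw [Morphisms.ProjFrame.comp_lift_actCore]
  exact key

/-- **LR-ACT in the consumer's letter**: over a locally Noetherian base, a frame rigidification moved by
`M ∈ GL_{m+1}(Γ(T, 𝒪_T))` is a LINEAR rigidification — the hypothesis of ★ (8α) `SiegelFramedCovariant.represents` ∕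
`classifyingMap` for the moved embedding `π^*M • ι` (★ (hBC) `IsFrameRigidification.isLinearRigidification`).
[cite: MumfordFogartyKirwan1994, Ch. 7 §2 Prop. 7.6 (p. 136)] [cite: MumfordFogartyKirwan1994, Ch. 7 §2 Def. 7.5 (p. 130)] -/
theorem IsFrameRigidification.isLinearRigidification_lift_actCore [IsLocallyNoetherian T]
    (h : P.IsFrameRigidification J ι) (M : GL (Fin (Nat.card J + 1)) Γ(T, ⊤)) :
    letI : Algebra intU.{0} Γ(P.A.X.left, ⊤) := (intCast _).toAlgebra
    P.IsLinearRigidification J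
      ((isPullback_projToSpec_projMap_terminal J Γ(P.A.X.left, ⊤)).lift P.A.X.left.toSpecΓ ι
          (terminal.hom_ext _ _) ≫ actCore J (Matrix.GeneralLinearGroup.map P.A.X.hom.appTop.hom M)) :=
  (h.lift_actCore J M).isLinearRigidification

end PolarizedAbelianSchemeWithLevel

end Literature.AlgebraicGeometry.AbelianSchemes

end
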